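import Summits.AtomisticToContinuum.BoseEinsteinCondensation.Theses.BECCutLineWeakDisorder
import Literature.MathematicalPhysics.QuantumManyBody.GroundState
import Literature.MathematicalPhysics.QuantumManyBody.BoseGasSymmetrisedProduct
import Literature.MathematicalPhysics.QuantumManyBody.BoseGasThermodynamicLimitRuelle
import Literature.MathematicalPhysics.QuantumManyBody.JelliumBoseGasProofs
import HarnessLib

/-!
# Reflection symmetry `x₀ ↦ L - x₀` of the Dirichlet box for `N`-body trial states

`GroundStateRigidity` (crux stmt-AtomisticToContinuum-9072, shared by 8 routes of `BoseEinsteinCondensation`):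
negative-side support by the refuter cdisprove seat (2026-08-16).  The four files
`Negative/BoxReflection.lean` → `Negative/TwoHardSpheresSupport.lean` → `Negative/TwoHardSpheresLocalisation.lean`
→ `Negative/TwoHardSpheres.lean` prove, sorry-free, that two unit hard spheres (`v = ⊤·1_{[0,1]}`, an
ADMISSIBLE interaction) in a box `Λ_L` with `1/3 < L² < 1/2` have finite ground-state energy but NO rigid
(phase-unique) ground state: the hard-core degeneracy mechanism of every route's why-might-fail, checked in
its smallest instance.  None of this refutes the crux (which lives at `L = (N/ρ)^{1/3} ≫ 1`, `ρ < ρ₀`); it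
shows that uniqueness for unbounded admissible `v` must USE low density.

This file: the reflection `reflC L` of the first Cartesian coordinate of every particle in the plane
`x₀ = L/2` — a linear involution `negC` (so `|det| = 1` and Lebesgue measure is preserved,
`map_linearMap_addHaar_eq_smul_addHaar`) followed by the translation `(L,0,0)`; it preserves the open box,
inter-particle distances, the interaction, the kinetic density (`kineticDensity_comp_reflC`), and maps
`TrialState N L` to itself (`reflectTS`) with the same energy (`energy_reflectTS`).
-/

noncomputable section

namespace Summit.AtomisticToContinuum.BoseEinsteinCondensation.Theorems.GroundStateRigidity.Negative.TwoHardSpheres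

open Literature.MathematicalPhysics.QuantumManyBody.BoseGas
open MeasureTheory Filter Metric
open scoped ENNReal NNReal Topology

variable {N : ℕ}

/-! ### Reflection of the box in its first coordinate plane -/

/-- Sign flip of the first Cartesian coordinate of every particle (linear part of the reflection). -/
def negC (N : ℕ) : Config N →ₗ[ℝ] Config N where
  toFun X := fun i => WithLp.toLp 2 fun k => if k = 0 then -(X i k) else X i k
  map_add' X Y := by
    funext i
    ext k
    by_cases hk : k = 0 <;> simp [hk] ; ring
  map_smul' c X := by
    funext i
    ext k
    by_cases hk : k = 0 <;> simp [hk]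

/-- Coordinates of `negC`. -/
theorem negC_apply (X : Config N) (i : Fin N) (k : Fin 3) :
    negC N X i k = if k = 0 then -(X i k) else X i k := rfl

/-- `negC` is an involution. -/
theorem negC_negC (X : Config N) : negC N (negC N X) = X := by
  funext i
  ext k
  by_cases hk : k = 0 <;> simp [negC_apply, hk]

/-- The shift `(L, 0, 0)` of every particle. -/
def shiftC (N : ℕ) (L : ℝ) : Config N := fun _ => WithLp.toLp 2 fun k => if k = 0 then L else 0

/-- Reflection `x₀ ↦ L - x₀` of the first coordinate of every particle. -/
def reflC (L : ℝ) (X : Config N) : Config N := negC N X + shiftC N L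

/-- Coordinates of the reflection: `x₀ ↦ L - x₀`, other coordinates unchanged. -/
theorem reflC_apply (L : ℝ) (X : Config N) (i : Fin N) (k : Fin 3) :
    reflC L X i k = if k = 0 then L - X i k else X i k := by
  simp only [reflC, Pi.add_apply, PiLp.add_apply, negC_apply, shiftC]
  by_cases hk : k = 0 <;> simp [hk] ; ring

/-- The reflection is an involution. -/
theorem reflC_reflC (L : ℝ) (X : Config N) : reflC L (reflC L X) = X := by
  funext i
  ext k
  by_cases hk : k = 0 <;> simp [reflC_apply, hk]

/-- The reflection acts particle-wise, hence commutes with relabelling. -/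
theorem reflC_comp_perm (L : ℝ) (X : Config N) (σ : Equiv.Perm (Fin N)) :
    reflC L (X ∘ σ) = reflC L X ∘ σ := by
  funext i
  ext k
  simp [reflC_apply]

/-- The reflection preserves inter-particle distances. -/
theorem dist_reflC (L : ℝ) (X : Config N) (i j : Fin N) :
    dist (reflC L X i) (reflC L X j) = dist (X i) (X j) := by
  simp only [EuclideanSpace.dist_eq]
  congr 1
  refine Finset.sum_congr rfl fun k _ => ?_
  by_cases hk : k = 0
  · subst hk
    simp only [reflC_apply, if_true, Real.dist_eq]
    rw [show L - X i 0 - (L - X j 0) = -(X i 0 - X j 0) by ring, abs_neg]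
  · simp [reflC_apply, hk, Real.dist_eq]

/-- The interaction is reflection invariant. -/
theorem interaction_reflC (v : ℝ → ℝ≥0∞) (L : ℝ) (X : Config N) :
    interaction v (reflC L X) = interaction v X := by
  simp only [interaction, dist_reflC]

/-- The reflection maps the open box onto itself. -/
theorem mem_boxN_reflC {L : ℝ} {X : Config N} : reflC L X ∈ boxN N L ↔ X ∈ boxN N L := by
  simp only [boxN, box, Set.mem_setOf_eq, Set.mem_Ioo]
  constructor
  · intro h i k
    have := h i k
    by_cases hk : k = 0
    · subst hk
      simp only [reflC_apply, if_true] at this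
      constructor <;> linarith [this.1, this.2]
    · simpa [reflC_apply, hk] using this
  · intro h i k
    have := h i k
    by_cases hk : k = 0
    · subst hk
      simp only [reflC_apply, if_true]
      constructor <;> linarith [this.1, this.2]
    · simpa [reflC_apply, hk] using this

/-- The linear part is an involution, so `|det| = 1`. -/
theorem abs_det_negC : |LinearMap.det (negC N)| = 1 := by
  have h2 : (negC N).comp (negC N) = LinearMap.id := by
    ext X i k
    simp [negC_negC]
  have hdet : LinearMap.det (negC N) * LinearMap.det (negC N) = 1 := by
    rw [← LinearMap.det_comp, h2, LinearMap.det_id]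
  have := congrArg abs hdet
  rw [abs_mul, abs_one] at this
  nlinarith [abs_nonneg (LinearMap.det (negC N))]

/-- `negC` is continuous. -/
theorem continuous_negC : Continuous (negC N) :=
  LinearMap.continuous_of_finiteDimensional _

/-- The reflection is continuous. -/
theorem continuous_reflC (L : ℝ) : Continuous (reflC (N := N) L) :=
  continuous_negC.add continuous_const

/-- The reflection as a homeomorphism (its own inverse). -/
def reflHomeo (N : ℕ) (L : ℝ) : Config N ≃ₜ Config N where
  toFun := reflC L
  invFun := reflC L
  left_inv := reflC_reflC L
  right_inv := reflC_reflC L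
  continuous_toFun := continuous_reflC L
  continuous_invFun := continuous_reflC L

/-- `negC` preserves Lebesgue measure (`|det| = 1`). -/
theorem map_negC_volume : Measure.map (negC N) (volume : Measure (Config N)) = volume := by
  have hdet : LinearMap.det (negC N) ≠ 0 := by
    intro h
    have := abs_det_negC (N := N)
    rw [h, abs_zero] at this
    exact zero_ne_one this
  rw [Measure.map_linearMap_addHaar_eq_smul_addHaar _ hdet, abs_inv, abs_det_negC, inv_one,
    ENNReal.ofReal_one, one_smul]

/-- The reflection preserves Lebesgue measure (linear involution plus a translation). -/
theorem measurePreserving_reflC (L : ℝ) :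
    MeasurePreserving (reflC (N := N) L) (volume : Measure (Config N)) volume := by
  have h1 : MeasurePreserving (negC N) (volume : Measure (Config N)) volume :=
    ⟨continuous_negC.measurable, map_negC_volume⟩
  have h2 : MeasurePreserving (fun X : Config N => X + shiftC N L) volume volume :=
    measurePreserving_add_right volume (shiftC N L)
  exact h2.comp h1

/-- Change of variables under the reflection. -/
theorem lintegral_comp_reflC (L : ℝ) (f : Config N → ℝ≥0∞) :
    ∫⁻ X, f (reflC L X) = ∫⁻ X, f X :=
  (measurePreserving_reflC L).lintegral_comp_emb (reflHomeo N L).measurableEmbedding f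

/-- `negC` as a continuous linear map, the derivative of `reflC`. -/
def negCL (N : ℕ) : Config N →L[ℝ] Config N := LinearMap.toContinuousLinearMap (negC N)

/-- The derivative of the reflection is `negC`. -/
theorem hasFDerivAt_reflC (L : ℝ) (X : Config N) : HasFDerivAt (reflC L) (negCL N) X := by
  have h1 : HasFDerivAt (negC N) (negCL N) X := (negCL N).hasFDerivAt
  exact h1.add_const (shiftC N L)

/-- The reflection is smooth (affine). -/
theorem contDiff_reflC (L : ℝ) : ContDiff ℝ 1 (reflC (N := N) L) :=
  ((negCL N).contDiff).add contDiff_const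

/-- `negC` maps the coordinate direction `e_{ik}` to `∓e_{ik}`. -/
theorem negCL_single (i : Fin N) (k : Fin 3) :
    negCL N (Pi.single i (EuclideanSpace.single k (1 : ℝ))) =
      (if k = 0 then (-1 : ℝ) else 1) • Pi.single i (EuclideanSpace.single k (1 : ℝ)) := by
  funext j
  ext k'
  simp only [negCL, LinearMap.coe_toContinuousLinearMap', negC_apply, Pi.smul_apply, PiLp.smul_apply,
    smul_eq_mul]
  by_cases hj : j = i
  · subst hj
    simp only [Pi.single_eq_same]
    by_cases hk' : k' = 0
    · subst hk'
      by_cases hk : k = 0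
      · subst hk; simp
      · simp [hk, Ne.symm hk]
    · simp only [hk', if_false]
      by_cases hk : k = 0
      · subst hk; simp [hk']
      · simp [hk]
  · simp [Pi.single_eq_of_ne hj]

/-- The kinetic density is reflection covariant. -/
theorem kineticDensity_comp_reflC {ψ : Config N → ℂ} (hψ : ContDiff ℝ 1 ψ) (L : ℝ) (X : Config N) :
    kineticDensity (fun Y => ψ (reflC L Y)) X = kineticDensity ψ (reflC L X) := by
  have hd : fderiv ℝ (fun Y => ψ (reflC L Y)) X = (fderiv ℝ ψ (reflC L X)).comp (negCL N) := by
    have h1 : HasFDerivAt ψ (fderiv ℝ ψ (reflC L X)) (reflC L X) :=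
      ((hψ.differentiable one_ne_zero) _).hasFDerivAt
    exact (h1.comp X (hasFDerivAt_reflC L X)).fderiv
  simp only [kineticDensity, hd, ContinuousLinearMap.comp_apply, negCL_single, map_smul]
  refine Finset.sum_congr rfl fun i _ => Finset.sum_congr rfl fun k _ => ?_
  by_cases hk : k = 0 <;> simp [hk, nnnorm_neg]

/-- Reflection of a trial state in the plane `x₀ = L/2`. -/
def reflectTS {L : ℝ} (Ψ : TrialState N L) : TrialState N L where
  ψ X := Ψ.ψ (reflC L X)
  contDiff := Ψ.contDiff.comp (contDiff_reflC L)
  eq_zero X hX := Ψ.eq_zero _ (fun h => hX (mem_boxN_reflC.1 h))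
  symm σ X := by
    show Ψ.ψ (reflC L (X ∘ σ)) = Ψ.ψ (reflC L X)
    rw [reflC_comp_perm, Ψ.symm]
  norm_eq := by
    rw [lintegral_comp_reflC L (fun X => (‖Ψ.ψ X‖₊ : ℝ≥0∞) ^ 2)]
    exact Ψ.norm_eq

/-- The wave function of the reflected state. -/
@[simp] theorem reflectTS_ψ {L : ℝ} (Ψ : TrialState N L) (X : Config N) :
    (reflectTS Ψ).ψ X = Ψ.ψ (reflC L X) := rfl

/-- **The energy is reflection invariant.** -/
theorem energy_reflectTS {L : ℝ} (v : ℝ → ℝ≥0∞) (Ψ : TrialState N L) :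
    energy v (reflectTS Ψ) = energy v Ψ := by
  unfold energy
  rw [← lintegral_comp_reflC L (fun X => kineticDensity Ψ.ψ X + interaction v X * (‖Ψ.ψ X‖₊ : ℝ≥0∞) ^ 2)]
  refine lintegral_congr fun X => ?_
  show kineticDensity (fun Y => Ψ.ψ (reflC L Y)) X + interaction v X * _ = _
  rw [kineticDensity_comp_reflC Ψ.contDiff, interaction_reflC]
  rfl


end Summit.AtomisticToContinuum.BoseEinsteinCondensation.Theorems.GroundStateRigidity.Negative.TwoHardSpheres

end
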